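import Literature.AlgebraicGeometry.Motives.HodgeStructureLefschetzGroupTraceTransferFactorFields
import Literature.AlgebraicGeometry.Motives.HodgeStructurePolarizationAdjointPoints
import Literature.AlgebraicGeometry.Motives.HodgeStructureEndActionCommutantCenterBicommutant
import Literature.AlgebraicGeometry.Motives.HodgeStructureEndActionBlockwiseCharpoly
import HarnessLib

/-!
# «THE INVOLUTION SENDS AN ELEMENT OF `Cᵢ` TO ITS ADJOINT WITH RESPECT TO `φᵢ`»: MILNE'S `†` ON THE COMMUTANT `C_K(F)` IS THE
# `φ_{Q,K}`-ADJOINT, BLOCK BY BLOCK THE `φ_𝔪`-ADJOINT, FIXES `ι_K(K ⊗ F) = Z(C_K(F))` (TYPE I) AND IS DETERMINED BY THE BLOCKS,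
# FOR EVERY FIELD `K ⊇ ℚ` (Milne 1999 §1 p. 642, §2 pp. 646–648)

[topic AlgebraicGeometry/Motives]

Layer `Literature/AlgebraicGeometry/Motives`, lane `lit-hodgefound` (Track 2 foundations library; prover seat
`lit-hodgefound-p02`, generation 58, self-proposed row g58-#7; sequel, BY NAME, of g58-#6
`Motives/HodgeStructureLefschetzGroupTraceTransferFactorFields` (components `φ_𝔪 = φ_{Q,K} mod 𝔪`, `φ_{Q,K}` non-degenerate,
«`φ = φ₁ ⊕ ⋯ ⊕ φ_t`»), p11's `Motives/HodgeStructurePolarizationAdjointPoints` (Milne's adjoint `β† = Q.adjointBaseChange K β`,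
`Q_K(βx, y) = Q_K(x, β†y)`, `(βγ)† = γ†β†`), g57-#7 `…CommutantCenterBicommutant` (`Z(C_K(F)) = ι_K(K ⊗_ℚ F)`) and g20-#1
`…LefschetzGroupTraceTransfer` (`forall_traceTransfer_apply_eq_apply_iff`: adjoints transfer along `Tr`)). THEOREMS ONLY: no
definition, no named fact (net debt `0`), no instance, no notation.

Milne (p. 642 L64–L70): «we let `β†` denote the adjoint with respect to `e_D` … `e_D(βx, y) = e_D(x, β†y)` … `β ↦ β†` is an
involution of the `k`-algebra `End_k(V(A))`»; (p. 646 L5–L9): «`F` = the subfield of `K` on which the Rosati involutions act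
trivially»; type I (p. 645 L32): «`E` is a totally real field, and the Rosati involutions are trivial»; (p. 648 L42–L52):
«`(Vᵢ, φᵢ) = (V(A), φ) ⊗_{F ⊗_ℚ k} Fᵢ` … `C(A) = C₁ × ⋯ × C_t`, `Cᵢ = End_{Fᵢ}(Vᵢ) ≈ M_{2g/f}(Fᵢ)` and the involution sends an
element of `Cᵢ` to its adjoint with respect to `φᵢ`.» On the tree's carrier (`Q : Polarization H`, `A : EndAction H F`, ANY field
`K ⊇ ℚ`, `ι_K = baseChangeAction K A.ι`, `C_K(F) = Subalgebra.centralizer K (range ι_K)`, `φ = Q.hermitianTransferBaseChange K A`,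
`γ† = Q.adjointBaseChange K γ`, Rosati condition `Q(ι(a)v, w) = Q(v, ι(σa)w)` for `σ : F ≃ₐ[ℚ] F`, «type I» = `σ = 1`) we PROVE:
(i) **`(ι_K z)† = ι_K(σ_K z)`**, type I: **`(ι_K z)† = ι_K z`**; hence **`C_K(F)` IS STABLE UNDER `†`**, and (type I) **`†` FIXES THE
CENTRE `Z(C_K(F)) = ι_K(K ⊗_ℚ F)` POINTWISE** («the subfield on which the Rosati involutions act trivially»);
(ii) **`φ(γx, y) = φ(x, γ†y)` FOR EVERY `γ ∈ C_K(F)`**: on the commutant of `F`, Milne's `e_D`-adjoint IS the `φ`-adjoint, and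
`γ†` is the UNIQUE map with this property (`φ` non-degenerate);
(iii) block by block: **`φ_𝔪(γx, y) = φ_𝔪(x, γ†y)`**, `γ†` preserves each block `V_𝔪`, and (type I) **`γ†` IS DETERMINED BY THE
`φ_𝔪`-ADJOINT CONDITIONS ON THE BLOCKS `V_𝔪 × V_𝔪`** — «the involution sends an element of `Cᵢ` to its adjoint with respect to `φᵢ`».

## The source, verbatim

J. S. Milne, *Lefschetz classes on abelian varieties*, Duke Math. J. **96** (1999) 639–675 [Milne1999LefschetzClasses] (held
`paper:doi-10-1215-s0012-7094-99-09620-5`; Duke page = folio + 638): §1 p. 642 (p0004) L64–L70, p. 645 (p0007) L32, p. 646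
(p0008) L5–L9 and L38–L42, §2 p. 648 (p0010) L42–L52 (quoted above).

## What is PROVED (namespace `Literature.AlgebraicGeometry.Motives.HodgeStructure`)

* §1 **`Polarization.adjointBaseChange_baseChangeAction_of_rosati`** (`(ι_K z)† = ι_K(σ_K z)`),
  **`Polarization.adjointBaseChange_baseChangeAction`** (type I: `(ι_K z)† = ι_K z`),
  **`Polarization.adjointBaseChange_mem_centralizer_range_of_rosati`** / **`…_mem_centralizer_range`** (`C_K(F)† ⊆ C_K(F)`),
  **`Polarization.adjointBaseChange_eq_self_of_mem_center_centralizer`** (type I: `†` is trivial on `Z(C_K(F))`).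
* §2 **`Polarization.hermitianTransferBaseChange_apply_eq_apply_adjointBaseChange`** (`φ(γx, y) = φ(x, γ†y)`, `γ ∈ C_K(F)`),
  **`Polarization.eq_adjointBaseChange_of_forall_hermitianTransferBaseChange`** (uniqueness of the `φ`-adjoint).
* §3 **`Polarization.mk_hermitianTransferBaseChange_apply_eq_mk_apply_adjointBaseChange`** (`φ_𝔪(γx, y) = φ_𝔪(x, γ†y)`),
  **`Polarization.adjointBaseChange_apply_mem_range_baseChangeAction`** (`γ†(V_𝔪) ⊆ V_𝔪`),
  **`Polarization.eq_adjointBaseChange_of_forall_mk_blocks`** (type I: the blockwise `φ_𝔪`-adjoint conditions determine `γ†`).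

NOT here: `†` for types II–IV beyond the Rosati-compatible `σ` on `F`; the `F_𝔪`-structure of `Cᵢ ≈ M_d(F_𝔪)` with its
involution of the first kind as a bundled algebra-with-involution.

Nearest tree results, BY NAME: p11 `Polarization.adjointBaseChange`, `eq_adjointBaseChange_of_isAdjointPair`, `adjointBaseChange_mul`,
`adjointBaseChange_adjointBaseChange`; g20-#1 `forall_traceTransfer_apply_eq_apply_iff`, `Polarization.baseChange_form_baseChangeAction_apply`,
`congr_refl_congr_refl_apply_of_involutive`; g58-#6 `Polarization.hermitianTransferBaseChange_nondegenerate`,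
`hermitianTransferBaseChange_eq_iff_forall_mk_eq`, `mk_hermitianTransferBaseChange_eq_mk_blocks`; g57-#7
`EndAction.mem_center_centralizer_range_iff`; g57-#6 `EndAction.apply_mem_range_baseChangeAction_of_mem_centralizer`; g56-#4
`HodgeStructureCentralizerInvolutionFieldExtension` (`†` on `C(H)(K)` along field extensions — the centralizer of `E_φ ⊗ K`).

## References

* [Milne1999LefschetzClasses] J. S. Milne, *Lefschetz classes on abelian varieties*, Duke Math. J. 96 (1999) 639–675, §1 p. 642
  L64–L70, p. 645 L32, p. 646 L5–L9, L38–L42; §2 p. 648 L42–L52.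
-/

noncomputable section

open scoped TensorProduct

namespace Literature.AlgebraicGeometry.Motives

namespace HodgeStructure

universe u uK

variable {V : Type u} [AddCommGroup V] [Module ℚ V] [Module.Finite ℚ V] {n : ℤ} {H : HodgeStructure V n}
variable {F : Type*} [Field F] [NumberField F]
variable (K : Type uK) [Field K] [Algebra ℚ K] (A : EndAction H F) (Q : Polarization H)

omit [Module.Finite ℚ V] in
/-- `congr refl refl = id` on `K ⊗_ℚ F`. [folklore] -/
private theorem congr_refl_refl_apply₅₈₇ (z : K ⊗[ℚ] F) :
    Algebra.TensorProduct.congr (AlgEquiv.refl : K ≃ₐ[K] K) (AlgEquiv.refl : F ≃ₐ[ℚ] F) z = z := by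
  induction z using TensorProduct.induction_on with
  | zero => simp
  | tmul c a => rw [Algebra.TensorProduct.congr_apply, Algebra.TensorProduct.map_tmul]; rfl
  | add x y hx hy => rw [map_add, hx, hy]

/-! ## §1 `†` on `ι_K(K ⊗ F)` and the `†`-stability of the commutant `C_K(F)` -/

/-- **`(ι_K z)† = ι_K(σ_K z)`** under the Rosati condition `Q(ι(a)v, w) = Q(v, ι(σa)w)` (`σ_K = 1 ⊗ σ`): the adjoint of the
action of `z ∈ K ⊗ F` is the action of `σ_K(z)`. [cite: Milne1999LefschetzClasses, §1 p. 642 L64–L70 and p. 646 L5–L9] -/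
theorem Polarization.adjointBaseChange_baseChangeAction_of_rosati (σ : F ≃ₐ[ℚ] F)
    (hros : ∀ a v w, Q.form (A.ι a v) w = Q.form v (A.ι (σ a) w)) (z : K ⊗[ℚ] F) :
    Q.adjointBaseChange K (baseChangeAction K A.ι z) =
      baseChangeAction K A.ι (Algebra.TensorProduct.congr (AlgEquiv.refl : K ≃ₐ[K] K) σ z) :=
  (Q.eq_adjointBaseChange_of_isAdjointPair K fun x y => Q.baseChange_form_baseChangeAction_apply K A σ hros z x y).symm

/-- **TYPE I (`†` trivial on `F`): `(ι_K z)† = ι_K z`** — the action of `K ⊗ F` consists of `†`-symmetric elements («the Rosati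
involutions are trivial» on `F`). [cite: Milne1999LefschetzClasses, §1 p. 645 L32 and p. 646 L5–L9] -/
theorem Polarization.adjointBaseChange_baseChangeAction (hsym : ∀ a v w, Q.form (A.ι a v) w = Q.form v (A.ι a w))
    (z : K ⊗[ℚ] F) : Q.adjointBaseChange K (baseChangeAction K A.ι z) = baseChangeAction K A.ι z := by
  rw [Q.adjointBaseChange_baseChangeAction_of_rosati K A AlgEquiv.refl hsym z, congr_refl_refl_apply₅₈₇]

/-- **THE COMMUTANT `C_K(F)` IS STABLE UNDER `†`** (Rosati condition for some `σ`): if `γ` commutes with `ι_K(K ⊗ F)` then so does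
`γ†` (`†` is an anti-automorphism carrying `ι_K(K ⊗ F)` onto itself) — «`C(A)` is a `k`-algebra stable under the involution `†`»
for the commutant of `F`. [cite: Milne1999LefschetzClasses, §1 p. 642 L70–L74 and §2 p. 646 L38] -/
theorem Polarization.adjointBaseChange_mem_centralizer_range_of_rosati (σ : F ≃ₐ[ℚ] F)
    (hros : ∀ a v w, Q.form (A.ι a v) w = Q.form v (A.ι (σ a) w)) {γ : Module.End K (K ⊗[ℚ] V)}
    (hγ : γ ∈ Subalgebra.centralizer K (Set.range (baseChangeAction K A.ι))) :
    Q.adjointBaseChange K γ ∈ Subalgebra.centralizer K (Set.range (baseChangeAction K A.ι)) := by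
  rw [Subalgebra.mem_centralizer_iff] at hγ ⊢
  rintro _ ⟨z, rfl⟩
  -- write `z = σ_K z'`, and apply `†` to `ι_K(z') γ = γ ι_K(z')`
  obtain ⟨z', rfl⟩ := (Algebra.TensorProduct.congr (AlgEquiv.refl : K ≃ₐ[K] K) σ).surjective z
  have h := congrArg (Q.adjointBaseChange K) (hγ _ ⟨z', rfl⟩)
  rw [Q.adjointBaseChange_mul K, Q.adjointBaseChange_mul K, Q.adjointBaseChange_baseChangeAction_of_rosati K A σ hros] at h
  exact h.symm

/-- **TYPE I: `C_K(F)` IS STABLE UNDER `†`.** [cite: Milne1999LefschetzClasses, §1 p. 642 L70–L74 and §2 p. 648 L45–L50] -/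
theorem Polarization.adjointBaseChange_mem_centralizer_range (hsym : ∀ a v w, Q.form (A.ι a v) w = Q.form v (A.ι a w))
    {γ : Module.End K (K ⊗[ℚ] V)} (hγ : γ ∈ Subalgebra.centralizer K (Set.range (baseChangeAction K A.ι))) :
    Q.adjointBaseChange K γ ∈ Subalgebra.centralizer K (Set.range (baseChangeAction K A.ι)) :=
  Q.adjointBaseChange_mem_centralizer_range_of_rosati K A AlgEquiv.refl hsym hγ

/-- **TYPE I: `†` IS TRIVIAL ON THE CENTRE `Z(C_K(F)) = ι_K(K ⊗_ℚ F)`** — the centre of «`C(A) = C₁ × ⋯ × C_t`» is `F ⊗ k = ∏ Fᵢ`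
(g57-#7) and «the Rosati involutions are trivial» on `F`: each simple factor `Cᵢ ≈ M_{2g/f}(Fᵢ)` carries an involution of the
first kind. [cite: Milne1999LefschetzClasses, §1 p. 645 L32, p. 646 L5–L9 and §2 p. 648 L45–L50] -/
theorem Polarization.adjointBaseChange_eq_self_of_mem_center_centralizer
    (hsym : ∀ a v w, Q.form (A.ι a v) w = Q.form v (A.ι a w))
    {γ : Subalgebra.centralizer K (Set.range (baseChangeAction K A.ι))}
    (hz : γ ∈ Subalgebra.center K (Subalgebra.centralizer K (Set.range (baseChangeAction K A.ι)))) :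
    Q.adjointBaseChange K (γ : Module.End K (K ⊗[ℚ] V)) = γ := by
  obtain ⟨u, hu⟩ := (A.mem_center_centralizer_range_iff K γ).1 hz
  rw [hu, Q.adjointBaseChange_baseChangeAction K A hsym]

/-! ## §2 On `C_K(F)` the `e_D`-adjoint is the `φ`-adjoint -/

/-- **`φ(γx, y) = φ(x, γ†y)` FOR EVERY `γ ∈ C_K(F)`**: Milne's `e_D`-adjoint of an `F ⊗ k`-linear map is its adjoint for the
transferred pairing `φ` (adjoints transfer along `Tr_{(K ⊗ F)/K}`). [cite: Milne1999LefschetzClasses, §2 p. 646 L41–L42 and p. 648 L45–L50] -/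
theorem Polarization.hermitianTransferBaseChange_apply_eq_apply_adjointBaseChange {γ : Module.End K (K ⊗[ℚ] V)}
    (hγ : γ ∈ Subalgebra.centralizer K (Set.range (baseChangeAction K A.ι))) (x y : K ⊗[ℚ] V) :
    Q.hermitianTransferBaseChange K A (γ x) y = Q.hermitianTransferBaseChange K A x (Q.adjointBaseChange K γ y) := by
  have hcomm : ∀ (z : K ⊗[ℚ] F) x, γ (baseChangeAction K A.ι z x) = baseChangeAction K A.ι z (γ x) := fun z x =>
    (congrArg (fun f : Module.End K (K ⊗[ℚ] V) => f x) ((Subalgebra.mem_centralizer_iff K).1 hγ _ ⟨z, rfl⟩)).symm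
  exact (forall_traceTransfer_apply_eq_apply_iff _ _ _ hcomm (Q.adjointBaseChange K γ)).2
    (fun x y => (Q.baseChange_form_apply_adjointBaseChange K γ x y).symm) x y

/-- **UNIQUENESS OF THE `φ`-ADJOINT**: if `γ ∈ C_K(F)` and `φ(γx, y) = φ(x, γ'y)` for all `x, y`, then `γ' = γ†` (`φ` is
non-degenerate). [cite: Milne1999LefschetzClasses, §1 p. 642 L64–L68 and §2 p. 648 L45–L50] -/
theorem Polarization.eq_adjointBaseChange_of_forall_hermitianTransferBaseChange {γ γ' : Module.End K (K ⊗[ℚ] V)}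
    (hγ : γ ∈ Subalgebra.centralizer K (Set.range (baseChangeAction K A.ι)))
    (h : ∀ x y, Q.hermitianTransferBaseChange K A (γ x) y = Q.hermitianTransferBaseChange K A x (γ' y)) :
    γ' = Q.adjointBaseChange K γ := by
  refine LinearMap.ext fun y => ?_
  rw [← sub_eq_zero]
  refine (Q.hermitianTransferBaseChange_nondegenerate K A).2 _ fun x => ?_
  rw [map_sub, ← h x y, Q.hermitianTransferBaseChange_apply_eq_apply_adjointBaseChange K A hγ x y, sub_self]

/-! ## §3 Block by block: «the involution sends an element of `Cᵢ` to its adjoint with respect to `φᵢ`» -/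

/-- **`φ_𝔪(γx, y) = φ_𝔪(x, γ†y)`** for `γ ∈ C_K(F)` and every `𝔪 ∈ MaxSpec(K ⊗_ℚ F)`: on each block the involution is the adjoint
with respect to the component `φ_𝔪`. [cite: Milne1999LefschetzClasses, §2 p. 648 L45–L50] -/
theorem Polarization.mk_hermitianTransferBaseChange_apply_eq_mk_apply_adjointBaseChange {γ : Module.End K (K ⊗[ℚ] V)}
    (hγ : γ ∈ Subalgebra.centralizer K (Set.range (baseChangeAction K A.ι))) (I : MaximalSpectrum (K ⊗[ℚ] F)) (x y : K ⊗[ℚ] V) :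
    Ideal.Quotient.mk I.asIdeal (Q.hermitianTransferBaseChange K A (γ x) y) =
      Ideal.Quotient.mk I.asIdeal (Q.hermitianTransferBaseChange K A x (Q.adjointBaseChange K γ y)) := by
  rw [Q.hermitianTransferBaseChange_apply_eq_apply_adjointBaseChange K A hγ]

/-- **`γ†` PRESERVES EVERY BLOCK `V_𝔪 = ι_K(e_𝔪)(K ⊗ V)`** (type I; `γ† ∈ C_K(F)`): «`αᵢ : Vᵢ → Vᵢ`» for `α = γ†`.
[cite: Milne1999LefschetzClasses, §2 p. 646 L48–L50 and p. 648 L45–L50] -/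
theorem Polarization.adjointBaseChange_apply_mem_range_baseChangeAction
    (hsym : ∀ a v w, Q.form (A.ι a v) w = Q.form v (A.ι a w)) {γ : Module.End K (K ⊗[ℚ] V)}
    (hγ : γ ∈ Subalgebra.centralizer K (Set.range (baseChangeAction K A.ι))) (u : K ⊗[ℚ] F) {x : K ⊗[ℚ] V}
    (hx : x ∈ LinearMap.range (baseChangeAction K A.ι u)) :
    Q.adjointBaseChange K γ x ∈ LinearMap.range (baseChangeAction K A.ι u) :=
  A.apply_mem_range_baseChangeAction_of_mem_centralizer K (Q.adjointBaseChange_mem_centralizer_range K A hsym hγ) u x hx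

/-- **THE BLOCKWISE `φ_𝔪`-ADJOINT CONDITIONS DETERMINE `γ†`** (type I): if `γ, γ' ∈ C_K(F)` and for every `𝔪` and all
`x, y ∈ V_𝔪`, `φ_𝔪(γx, y) = φ_𝔪(x, γ'y)`, then `γ' = γ†` — «`C(A) = C₁ × ⋯ × C_t` … and the involution sends an element of `Cᵢ` to
its adjoint with respect to `φᵢ`»: `†` on the commutant is the product of the `φᵢ`-adjoints.
[cite: Milne1999LefschetzClasses, §2 p. 648 L42–L52] -/
theorem Polarization.eq_adjointBaseChange_of_forall_mk_blocks (hsym : ∀ a v w, Q.form (A.ι a v) w = Q.form v (A.ι a w))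
    (e : MaximalSpectrum (K ⊗[ℚ] F) → K ⊗[ℚ] F)
    (he : ∀ I, IsIdempotentElem (e I) ∧ e I ∉ I.asIdeal ∧ ∀ J : MaximalSpectrum (K ⊗[ℚ] F), J ≠ I → e I ∈ J.asIdeal)
    {γ γ' : Module.End K (K ⊗[ℚ] V)} (hγ : γ ∈ Subalgebra.centralizer K (Set.range (baseChangeAction K A.ι)))
    (hγ' : γ' ∈ Subalgebra.centralizer K (Set.range (baseChangeAction K A.ι)))
    (h : ∀ I : MaximalSpectrum (K ⊗[ℚ] F), ∀ x ∈ LinearMap.range (baseChangeAction K A.ι (e I)),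
      ∀ y ∈ LinearMap.range (baseChangeAction K A.ι (e I)),
        Ideal.Quotient.mk I.asIdeal (Q.hermitianTransferBaseChange K A (γ x) y) =
          Ideal.Quotient.mk I.asIdeal (Q.hermitianTransferBaseChange K A x (γ' y))) :
    γ' = Q.adjointBaseChange K γ := by
  have hcomm : ∀ (z : K ⊗[ℚ] F) x, γ (baseChangeAction K A.ι z x) = baseChangeAction K A.ι z (γ x) := fun z x =>
    (congrArg (fun f : Module.End K (K ⊗[ℚ] V) => f x) ((Subalgebra.mem_centralizer_iff K).1 hγ _ ⟨z, rfl⟩)).symm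
  have hcomm' : ∀ (z : K ⊗[ℚ] F) x, γ' (baseChangeAction K A.ι z x) = baseChangeAction K A.ι z (γ' x) := fun z x =>
    (congrArg (fun f : Module.End K (K ⊗[ℚ] V) => f x) ((Subalgebra.mem_centralizer_iff K).1 hγ' _ ⟨z, rfl⟩)).symm
  refine Q.eq_adjointBaseChange_of_forall_hermitianTransferBaseChange K A hγ fun x y => ?_
  rw [Q.hermitianTransferBaseChange_eq_iff_forall_mk_eq K A]
  intro I
  rw [Q.mk_hermitianTransferBaseChange_eq_mk_blocks K A hsym I (he I).1 (he I).2.1 (γ x) y, ← hcomm,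
    h I _ (LinearMap.mem_range_self _ x) _ (LinearMap.mem_range_self _ y), hcomm',
    ← Q.mk_hermitianTransferBaseChange_eq_mk_blocks K A hsym I (he I).1 (he I).2.1 x (γ' y)]

end HodgeStructure

end Literature.AlgebraicGeometry.Motives
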